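import Summits.AtomisticToContinuum.Crystallization.Theorems.ThreeConeCertificateExactCertificateInvisibility
import Summits.AtomisticToContinuum.Crystallization.Theorems.ThreeConeCertificateExactCertificateFarEqualFourierReal
import Summits.AtomisticToContinuum.Crystallization.Theorems.ThreeConeCertificateExactCertificateFarEqualSliceBridge
import Summits.AtomisticToContinuum.Crystallization.Theorems.ThreeConeCertificateExactCertificateFarEqualPlaneIntegral
import Summits.AtomisticToContinuum.Crystallization.Theorems.ThreeConeCertificateExactCertificateFarEqualTailCos
import HarnessLib

/-!
# Crux `ExactCertificate` (stmt-AtomisticToContinuum-11959), line `closure-makes-nogap-exact`, skeleton IX (`FarSlackActive`):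
# registered stub `stub_sliceMaxPow` (lead) — the slice of the capped power kernel is entire on `s > 0`

Support file for the crux `ThreeConeCertificate.ExactCertificate`; nothing here closes the 3-D crux.  The analytic input of the
refutation of the census's S⁺₂ (`…FarEqual.lean`): for `m ≥ 3` and `ρ > 0` the slice `s ↦ 𝓕[max(‖·‖², ρ²)^{−m}](s e₀)` of the Fourier
transform of the capped power on `ℝ³` coincides on `s > 0` with an ENTIRE function of exponential type.  Mechanism: slice
`ℝ³ = ℝ × ℝ²` (F1 `stub_sliceBridge`), explicit plank profile `π/(m−1)·max(|x|,ρ)^{2−2m} + π(ρ² − x²)₊ρ^{−2m}` (F2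
`stub_planeIntegralMaxPow`), compactly supported pieces by the 1-D Paley–Wiener half (F0 `stub_fourierEntireReal`), and the power tail
`|x|^{2−2m}𝟙_{|x|>ρ}` by evenness (`integral_comp_abs`) and the cosine-transform theorem (F6 `stub_tailCosTransform`: Taylor subtraction +
scaling, no Dirichlet integral).  The statements of F0, F1, F2, F6 enter as hypotheses (they are landed tree theorems; the assembly
`…FarEqual.lean` plugs them in).  All `[folklore]`.
-/

noncomputable section

namespace Summit.AtomisticToContinuum.Crystallization.Theorems.ThreeConeCertificateExactCertificate.FarEqual

open MeasureTheory Set Filter Topology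
open scoped BigOperators FourierTransform RealInnerProductSpace

/-! ## The capped power kernel: integrability and the analytic input `stub_sliceMaxPow` -/

/-- The capped power `max(‖v‖², ρ²)^{−m}` (`ρ > 0`, `m ≥ 3`) is continuous and `≤ c^{−m}(1 + ‖v‖)^{−6}` with
`c = ρ²/(1+ρ)²`, hence integrable on `ℝ³`. [folklore] -/
theorem integrable_maxPow' {ρ : ℝ} (hρ : 0 < ρ) {m : ℕ} (hm : 3 ≤ m) :
    Integrable (fun v : EuclideanSpace ℝ (Fin 3) => ((((max (‖v‖ ^ 2) (ρ ^ 2))⁻¹) ^ m : ℝ) : ℂ)) := by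
  have hpos : ∀ v : EuclideanSpace ℝ (Fin 3), 0 < max (‖v‖ ^ 2) (ρ ^ 2) := fun v =>
    lt_of_lt_of_le (by positivity) (le_max_right _ _)
  have hcont : Continuous fun v : EuclideanSpace ℝ (Fin 3) => ((((max (‖v‖ ^ 2) (ρ ^ 2))⁻¹) ^ m : ℝ) : ℂ) := by
    refine Complex.continuous_ofReal.comp ?_
    refine Continuous.pow (Continuous.inv₀ ?_ fun v => (hpos v).ne') m
    exact (continuous_norm.pow 2).max continuous_const
  set c : ℝ := ρ ^ 2 / (1 + ρ) ^ 2 with hc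
  have hc0 : 0 < c := by positivity
  have hc1 : c ≤ 1 := by
    rw [hc, div_le_one (by positivity)]; nlinarith
  -- `c (1 + r)² ≤ max(r², ρ²)`
  have hkey : ∀ r : ℝ, 0 ≤ r → c * (1 + r) ^ 2 ≤ max (r ^ 2) (ρ ^ 2) := by
    intro r hr
    rcases le_or_gt ρ r with h | h
    · refine le_trans ?_ (le_max_left _ _)
      rw [hc, div_mul_eq_mul_div, div_le_iff₀ (by positivity)]
      have : ρ * (1 + r) ≤ r * (1 + ρ) := by nlinarith
      nlinarith [mul_pos hρ (by linarith : (0:ℝ) < 1 + r)]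
    · refine le_trans ?_ (le_max_right _ _)
      rw [hc, div_mul_eq_mul_div, div_le_iff₀ (by positivity)]
      have : (1 + r) ^ 2 ≤ (1 + ρ) ^ 2 := by gcongr
      nlinarith [sq_nonneg ρ]
  have hle : ∀ v : EuclideanSpace ℝ (Fin 3),
      ‖((((max (‖v‖ ^ 2) (ρ ^ 2))⁻¹) ^ m : ℝ) : ℂ)‖ ≤ (c⁻¹) ^ m * (1 + ‖v‖) ^ (-(6 : ℝ)) := by
    intro v
    set M : ℝ := max (‖v‖ ^ 2) (ρ ^ 2) with hM
    have hMpos : 0 < M := hpos v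
    rw [Complex.norm_real, Real.norm_eq_abs, abs_of_nonneg (by positivity)]
    have h1 : c * (1 + ‖v‖) ^ 2 ≤ M := hkey ‖v‖ (norm_nonneg _)
    -- `M⁻¹ ≤ c⁻¹ (1+‖v‖)⁻²` and `M⁻¹ ≤ c⁻¹`-type bounds
    have h2 : M⁻¹ ≤ c⁻¹ * ((1 + ‖v‖) ^ 2)⁻¹ := by
      rw [← mul_inv, inv_le_inv₀ hMpos (by positivity)]; exact h1
    have h3 : M⁻¹ ≤ c⁻¹ := by
      refine h2.trans (mul_le_of_le_one_right (by positivity) ?_)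
      exact inv_le_one_of_one_le₀ (by nlinarith [norm_nonneg v])
    have h4 : (M⁻¹) ^ m ≤ (c⁻¹) ^ (m - 3) * (M⁻¹) ^ 3 := by
      rw [show m = (m - 3) + 3 by omega, pow_add, Nat.add_sub_cancel]
      exact mul_le_mul_of_nonneg_right (pow_le_pow_left₀ (by positivity) h3 _) (by positivity)
    have h5 : (M⁻¹) ^ 3 ≤ (c⁻¹) ^ 3 * (1 + ‖v‖) ^ (-(6 : ℝ)) := by
      rw [Real.rpow_neg (by positivity), show (6 : ℝ) = ((6 : ℕ) : ℝ) by norm_num, Real.rpow_natCast,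
        show (1 + ‖v‖) ^ 6 = ((1 + ‖v‖) ^ 2) ^ 3 by ring, ← inv_pow, ← mul_pow]
      exact pow_le_pow_left₀ (by positivity) h2 3
    calc (M⁻¹) ^ m ≤ (c⁻¹) ^ (m - 3) * (M⁻¹) ^ 3 := h4
      _ ≤ (c⁻¹) ^ (m - 3) * ((c⁻¹) ^ 3 * (1 + ‖v‖) ^ (-(6 : ℝ))) := by gcongr
      _ = (c⁻¹) ^ m * (1 + ‖v‖) ^ (-(6 : ℝ)) := by
          rw [← mul_assoc, ← pow_add, show m - 3 + 3 = m by omega]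
  refine (((integrable_one_add_norm (E := EuclideanSpace ℝ (Fin 3)) (μ := volume) (r := 6) ?_).const_mul
    ((c⁻¹) ^ m))).mono' hcont.aestronglyMeasurable (ae_of_all _ hle)
  rw [finrank_euclideanSpace_fin]; norm_num

/-- **Registered stub `stub_sliceMaxPow` (lead): the slice of the capped power is entire on `s > 0`.**  Given the statements of
F0 (`stub_fourierEntireReal`), F1 (`stub_sliceBridge`), F2 (`stub_planeIntegralMaxPow`) and the conclusion of F6 (`stub_tailCosTransform`)
as hypotheses, for `m ≥ 3` and `ρ > 0` there is an entire `Θ` of exponential type with `Θ(s) = 𝓕[max(‖·‖², ρ²)^{−m}](s e₀)` for all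
`s > 0` (plank profile `= π/(m−1)·max(|x|,ρ)^{2−2m} + π(ρ² − x²)₊ρ^{−2m}`; compact pieces by F0; the tail by evenness,
`integral_comp_abs` and F6 at `σ = 2πs`). [folklore] -/
theorem stub_sliceMaxPow : (∀ (p : ℝ → ℂ) (L : ℝ), MeasureTheory.Integrable p → (∀ x : ℝ, L < |x| → p x = 0) →
      ∃ Φ : ℂ → ℂ, Differentiable ℂ Φ ∧ (∃ B τ : ℝ, ∀ z : ℂ, ‖Φ z‖ ≤ B * Real.exp (τ * ‖z‖)) ∧
        ∀ s : ℝ, Φ (s : ℂ) = 𝓕 p s) →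
    (∀ (G : EuclideanSpace ℝ (Fin 3) → ℂ), MeasureTheory.Integrable G →
      MeasureTheory.Integrable (fun x : ℝ => ∫ y : EuclideanSpace ℝ (Fin 2), G !₂[x, y 0, y 1]) ∧
        ∀ s : ℝ, 𝓕 G (s • EuclideanSpace.single (0 : Fin 3) (1 : ℝ)) =
          𝓕 (fun x : ℝ => ∫ y : EuclideanSpace ℝ (Fin 2), G !₂[x, y 0, y 1]) s) →
    (∀ (m : ℕ) (ρ x : ℝ), 2 ≤ m → 0 < ρ →
      MeasureTheory.Integrable (fun y : EuclideanSpace ℝ (Fin 2) => ((max (x ^ 2 + ‖y‖ ^ 2) (ρ ^ 2))⁻¹) ^ m) ∧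
        ∫ y : EuclideanSpace ℝ (Fin 2), ((max (x ^ 2 + ‖y‖ ^ 2) (ρ ^ 2))⁻¹) ^ m =
          Real.pi / ((m : ℝ) - 1) * ((max (x ^ 2) (ρ ^ 2))⁻¹) ^ (m - 1) +
            Real.pi * max (ρ ^ 2 - x ^ 2) 0 * ((ρ ^ 2)⁻¹) ^ m) →
    (∀ (n : ℕ) (ρ : ℝ), 0 < ρ → ∃ E : ℂ → ℂ, Differentiable ℂ E ∧
        (∃ B τ : ℝ, ∀ z : ℂ, ‖E z‖ ≤ B * Real.exp (τ * ‖z‖)) ∧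
        ∀ σ : ℝ, 0 < σ → E (σ : ℂ) = ((∫ x in Set.Ioi ρ, (x ^ (2 * n + 2))⁻¹ * Real.cos (σ * x) : ℝ) : ℂ)) →
    ∀ (m : ℕ) (ρ : ℝ), 3 ≤ m → 0 < ρ → ∃ Θ : ℂ → ℂ, Differentiable ℂ Θ ∧
        (∃ B τ : ℝ, ∀ z : ℂ, ‖Θ z‖ ≤ B * Real.exp (τ * ‖z‖)) ∧
        ∀ s : ℝ, 0 < s → Θ (s : ℂ) =
          𝓕 (fun v : EuclideanSpace ℝ (Fin 3) => ((((max (‖v‖ ^ 2) (ρ ^ 2))⁻¹) ^ m : ℝ) : ℂ))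
            (s • EuclideanSpace.single (0 : Fin 3) (1 : ℝ)) := by
  intro hF0 hF1 hF2 hC6 m ρ hm hρ
  have hm2 : 2 ≤ m := le_trans (by norm_num) hm
  have hm1r : (1 : ℝ) < m := by exact_mod_cast (lt_of_lt_of_le (by norm_num) hm : 1 < m)
  -- the kernel and its integrability
  set G : EuclideanSpace ℝ (Fin 3) → ℂ := fun v => ((((max (‖v‖ ^ 2) (ρ ^ 2))⁻¹) ^ m : ℝ) : ℂ) with hGdef
  have hGi : Integrable G := integrable_maxPow' hρ hm
  obtain ⟨hPi, hslice⟩ := hF1 G hGi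
  -- the plank profile, explicitly
  set c₁ : ℝ := Real.pi / ((m : ℝ) - 1) with hc₁
  have hprof : ∀ x : ℝ, (∫ y : EuclideanSpace ℝ (Fin 2), G !₂[x, y 0, y 1]) =
      ((c₁ * ((max (x ^ 2) (ρ ^ 2))⁻¹) ^ (m - 1) + Real.pi * max (ρ ^ 2 - x ^ 2) 0 * ((ρ ^ 2)⁻¹) ^ m : ℝ) : ℂ) := by
    intro x
    have hns : ∀ y : EuclideanSpace ℝ (Fin 2), ‖(!₂[x, y 0, y 1] : EuclideanSpace ℝ (Fin 3))‖ ^ 2 = x ^ 2 + ‖y‖ ^ 2 := by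
      intro y
      rw [EuclideanSpace.norm_sq_eq, EuclideanSpace.norm_sq_eq, Fin.sum_univ_three, Fin.sum_univ_two]
      simp
      ring
    have hG : ∀ y : EuclideanSpace ℝ (Fin 2), G !₂[x, y 0, y 1] =
        ((((max (x ^ 2 + ‖y‖ ^ 2) (ρ ^ 2))⁻¹) ^ m : ℝ) : ℂ) := by
      intro y; simp only [hGdef, hns y]
    simp_rw [hG]
    rw [integral_complex_ofReal, (hF2 m ρ x hm2 hρ).2, hc₁]
  -- the three pieces of the profile
  set Pbox : ℝ → ℂ := fun x => if |x| ≤ ρ then ((c₁ * ((ρ ^ 2)⁻¹) ^ (m - 1) : ℝ) : ℂ) else 0 with hPbox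
  set h : ℝ → ℝ := fun u => c₁ * ((u ^ 2)⁻¹) ^ (m - 1) with hh
  set g : ℝ → ℝ := (Set.Ioi ρ).indicator h with hg
  set Ptail : ℝ → ℂ := fun x => ((g |x| : ℝ) : ℂ) with hPtail
  set PB : ℝ → ℂ := fun x => ((Real.pi * max (ρ ^ 2 - x ^ 2) 0 * ((ρ ^ 2)⁻¹) ^ m : ℝ) : ℂ) with hPB
  have hsplit : ∀ x : ℝ, (∫ y : EuclideanSpace ℝ (Fin 2), G !₂[x, y 0, y 1]) = Pbox x + Ptail x + PB x := by
    intro x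
    rw [hprof x]
    by_cases hx : |x| ≤ ρ
    · have hx2 : x ^ 2 ≤ ρ ^ 2 := by
        rw [← sq_abs]; exact pow_le_pow_left₀ (abs_nonneg x) hx 2
      have hmax : max (x ^ 2) (ρ ^ 2) = ρ ^ 2 := max_eq_right hx2
      have hgx : g |x| = 0 := by
        rw [hg, Set.indicator_of_notMem]; simpa using hx
      simp only [hPbox, hPtail, hPB, if_pos hx, hmax, hgx]
      push_cast; ring
    · rw [not_le] at hx
      have hx2 : ρ ^ 2 < x ^ 2 := by
        rw [← sq_abs x]; exact pow_lt_pow_left₀ hx hρ.le two_ne_zero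
      have hmax : max (x ^ 2) (ρ ^ 2) = x ^ 2 := max_eq_left hx2.le
      have hgx : g |x| = c₁ * ((x ^ 2)⁻¹) ^ (m - 1) := by
        rw [hg, Set.indicator_of_mem (by simpa using hx), hh]; simp [sq_abs]
      have hmax0 : max (ρ ^ 2 - x ^ 2) 0 = 0 := max_eq_right (by linarith)
      simp only [hPbox, hPtail, hPB, if_neg (not_le.2 hx), hmax, hgx, hmax0]
      push_cast; ring
  -- integrability of the pieces
  have hPbox_eq : Pbox = (Set.Icc (-ρ) ρ).indicator (fun _ => ((c₁ * ((ρ ^ 2)⁻¹) ^ (m - 1) : ℝ) : ℂ)) := by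
    funext x
    simp only [hPbox, Set.indicator_apply, Set.mem_Icc, abs_le]
  have hPbox_i : Integrable Pbox := by
    rw [hPbox_eq, integrable_indicator_iff measurableSet_Icc]
    exact integrableOn_const (by simp)
  have hPB_cont : Continuous PB := by
    rw [hPB]; fun_prop
  have hPB_supp : ∀ x : ℝ, ρ < |x| → PB x = 0 := by
    intro x hx
    have hx2 : ρ ^ 2 < x ^ 2 := by
      rw [← sq_abs x]; exact pow_lt_pow_left₀ hx hρ.le two_ne_zero
    simp only [hPB, max_eq_right (by linarith : ρ ^ 2 - x ^ 2 ≤ 0)]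
    push_cast; ring
  have hPB_i : Integrable PB := by
    refine hPB_cont.integrable_of_hasCompactSupport ?_
    refine HasCompactSupport.of_support_subset_isCompact (isCompact_Icc (a := -ρ) (b := ρ)) ?_
    intro x hx
    rw [Set.mem_Icc, ← abs_le]
    by_contra habs
    exact hx (hPB_supp x (not_le.1 habs))
  have hPbox_supp : ∀ x : ℝ, ρ < |x| → Pbox x = 0 := fun x hx => by
    simp only [hPbox, if_neg (not_le.2 hx)]
  have hPtail_i : Integrable Ptail := by
    have : Ptail = fun x => (∫ y : EuclideanSpace ℝ (Fin 2), G !₂[x, y 0, y 1]) - Pbox x - PB x := by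
      funext x; rw [hsplit x]; ring
    rw [this]
    exact (hPi.sub hPbox_i).sub hPB_i
  -- entire extensions of the Fourier transforms of the compact pieces (F0) and of the tail (F6)
  obtain ⟨Φ₁, hΦ₁d, ⟨B₁, τ₁, hB₁⟩, hΦ₁F⟩ := hF0 Pbox ρ hPbox_i hPbox_supp
  obtain ⟨Φ₂, hΦ₂d, ⟨B₂, τ₂, hB₂⟩, hΦ₂F⟩ := hF0 PB ρ hPB_i hPB_supp
  obtain ⟨E, hEd, ⟨B₃, τ₃, hB₃⟩, hEF⟩ := hC6 (m - 2) ρ hρ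
  have hpow : 2 * (m - 2) + 2 = 2 * (m - 1) := by omega
  -- the Fourier transform of the tail for `s > 0`
  have htail : ∀ s : ℝ, 0 < s → 𝓕 Ptail s = ((2 * c₁ : ℝ) : ℂ) * E ((2 * Real.pi * s : ℝ) : ℂ) := by
    intro s hs
    -- symmetrise: `𝓕 Ptail s = ∫ cos(2π x s) Ptail x`
    set e : ℝ → ℂ := fun x => Complex.exp (↑(-2 * Real.pi * x * s) * Complex.I) with he
    have hF : 𝓕 Ptail s = ∫ x : ℝ, e x * Ptail x := by
      rw [Real.fourier_real_eq_integral_exp_smul]; rfl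
    have heven : ∀ x : ℝ, Ptail (-x) = Ptail x := fun x => by simp only [hPtail, abs_neg]
    have hneg : ∫ x : ℝ, e x * Ptail x = ∫ x : ℝ, e (-x) * Ptail x := by
      rw [← integral_neg_eq_self (fun x => e x * Ptail x) volume]
      exact integral_congr_ae (ae_of_all _ fun x => by simp only [heven])
    have hint_e : ∀ (ε : ℝ → ℂ), Continuous ε → (∀ x, ‖ε x‖ = 1) → Integrable fun x => ε x * Ptail x :=
      fun ε hc hn => hPtail_i.bdd_mul (c := 1) hc.aestronglyMeasurable (ae_of_all _ fun x => (hn x).le)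
    have he_c : Continuous e := by rw [he]; fun_prop
    have he_n : ∀ x, ‖e x‖ = 1 := fun x => Complex.norm_exp_ofReal_mul_I _
    have hen_c : Continuous fun x => e (-x) := he_c.comp continuous_neg
    have hcos : ∀ x : ℝ, e x + e (-x) = 2 * (Real.cos (2 * Real.pi * x * s) : ℂ) := by
      intro x
      rw [Complex.ofReal_cos, Complex.two_cos, he]
      push_cast
      rw [add_comm]
      congr 1 <;> congr 1 <;> ring
    have hsym : ∫ x : ℝ, e x * Ptail x = ∫ x : ℝ, (Real.cos (2 * Real.pi * x * s) : ℂ) * Ptail x := by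
      have h2 : 2 * ∫ x : ℝ, e x * Ptail x = 2 * ∫ x : ℝ, (Real.cos (2 * Real.pi * x * s) : ℂ) * Ptail x := by
        calc 2 * ∫ x : ℝ, e x * Ptail x = (∫ x : ℝ, e x * Ptail x) + ∫ x : ℝ, e (-x) * Ptail x := by
              rw [two_mul, ← hneg]
          _ = ∫ x : ℝ, (e x * Ptail x + e (-x) * Ptail x) :=
              (integral_add (hint_e e he_c he_n) (hint_e _ hen_c fun x => he_n (-x))).symm
          _ = ∫ x : ℝ, 2 * ((Real.cos (2 * Real.pi * x * s) : ℂ) * Ptail x) :=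
              integral_congr_ae (ae_of_all _ fun x => by
                show e x * Ptail x + e (-x) * Ptail x = 2 * ((Real.cos (2 * Real.pi * x * s) : ℂ) * Ptail x)
                rw [← add_mul, hcos]; ring)
          _ = 2 * ∫ x : ℝ, (Real.cos (2 * Real.pi * x * s) : ℂ) * Ptail x := integral_const_mul _ _
      exact mul_left_cancel₀ two_ne_zero h2
    -- reduce to `(0, ∞)` and then to `(ρ, ∞)`
    have hreal : ∫ x : ℝ, (Real.cos (2 * Real.pi * x * s) : ℂ) * Ptail x =
        ((∫ x : ℝ, Real.cos (2 * Real.pi * |x| * s) * g |x| : ℝ) : ℂ) := by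
      rw [← integral_complex_ofReal]
      refine integral_congr_ae (ae_of_all _ fun x => ?_)
      show (Real.cos (2 * Real.pi * x * s) : ℂ) * Ptail x = ((Real.cos (2 * Real.pi * |x| * s) * g |x| : ℝ) : ℂ)
      simp only [hPtail]
      rcases le_or_gt 0 x with hx | hx
      · rw [abs_of_nonneg hx]; push_cast; ring
      · rw [abs_of_neg hx, show (2 * Real.pi * -x * s : ℝ) = -(2 * Real.pi * x * s) by ring, Real.cos_neg]
        push_cast; ring
    have habs : ∫ x : ℝ, Real.cos (2 * Real.pi * |x| * s) * g |x| =
        2 * ∫ x in Set.Ioi (0 : ℝ), Real.cos (2 * Real.pi * x * s) * g x :=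
      integral_comp_abs (f := fun u => Real.cos (2 * Real.pi * u * s) * g u)
    have hIoi : ∫ x in Set.Ioi (0 : ℝ), Real.cos (2 * Real.pi * x * s) * g x =
        c₁ * ∫ x in Set.Ioi ρ, (x ^ (2 * (m - 2) + 2))⁻¹ * Real.cos (2 * Real.pi * s * x) := by
      have hind : (fun x => Real.cos (2 * Real.pi * x * s) * g x) =
          (Set.Ioi ρ).indicator (fun x => Real.cos (2 * Real.pi * x * s) * h x) := by
        funext x
        simp only [hg, Set.indicator_apply]
        split_ifs <;> simp
      rw [hind, setIntegral_indicator measurableSet_Ioi,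
        show Set.Ioi (0 : ℝ) ∩ Set.Ioi ρ = Set.Ioi ρ from
          Set.inter_eq_right.2 (Set.Ioi_subset_Ioi hρ.le),
        ← integral_const_mul]
      refine setIntegral_congr_fun measurableSet_Ioi fun x _ => ?_
      simp only [hh, hpow]
      rw [show (x ^ 2)⁻¹ ^ (m - 1) = (x ^ (2 * (m - 1)))⁻¹ by rw [pow_mul, inv_pow]]
      ring_nf
    rw [hF, hsym, hreal, habs, hIoi, hEF (2 * Real.pi * s) (by positivity)]
    push_cast
    ring
  -- assemble
  refine ⟨fun z => Φ₁ z + Φ₂ z + ((2 * c₁ : ℝ) : ℂ) * E (2 * Real.pi * z), ?_, ?_, ?_⟩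
  · exact (hΦ₁d.add hΦ₂d).add ((hEd.comp (differentiable_id.const_mul _)).const_mul _)
  · set T : ℝ := |τ₁| + |τ₂| + 2 * Real.pi * |τ₃| with hT
    refine ⟨|B₁| + |B₂| + 2 * |c₁| * |B₃|, T, fun z => ?_⟩
    have hexp : ∀ (τ : ℝ) (w : ℝ), 0 ≤ w → τ * w ≤ T * ‖z‖ → Real.exp (τ * w) ≤ Real.exp (T * ‖z‖) :=
      fun τ w _ h => Real.exp_le_exp.2 h
    have hπ : 0 < Real.pi := Real.pi_pos
    have hz2 : ‖(2 * Real.pi * z : ℂ)‖ = 2 * Real.pi * ‖z‖ := by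
      rw [norm_mul, show ‖(2 * Real.pi : ℂ)‖ = 2 * Real.pi by
        rw [show (2 * Real.pi : ℂ) = ((2 * Real.pi : ℝ) : ℂ) by push_cast; ring, Complex.norm_real,
          Real.norm_eq_abs, abs_of_pos (by positivity)]]
    have hTz : T * ‖z‖ = |τ₁| * ‖z‖ + |τ₂| * ‖z‖ + 2 * Real.pi * |τ₃| * ‖z‖ := by rw [hT]; ring
    have p₁ : 0 ≤ |τ₁| * ‖z‖ := mul_nonneg (abs_nonneg _) (norm_nonneg _)
    have p₂ : 0 ≤ |τ₂| * ‖z‖ := mul_nonneg (abs_nonneg _) (norm_nonneg _)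
    have p₃ : 0 ≤ 2 * Real.pi * |τ₃| * ‖z‖ := by positivity
    have g₁ : ‖Φ₁ z‖ ≤ |B₁| * Real.exp (T * ‖z‖) := by
      refine (hB₁ z).trans ((mul_le_mul_of_nonneg_right (le_abs_self _) (Real.exp_pos _).le).trans
        (mul_le_mul_of_nonneg_left (Real.exp_le_exp.2 ?_) (abs_nonneg _)))
      have : τ₁ * ‖z‖ ≤ |τ₁| * ‖z‖ := mul_le_mul_of_nonneg_right (le_abs_self _) (norm_nonneg _)
      linarith
    have g₂ : ‖Φ₂ z‖ ≤ |B₂| * Real.exp (T * ‖z‖) := by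
      refine (hB₂ z).trans ((mul_le_mul_of_nonneg_right (le_abs_self _) (Real.exp_pos _).le).trans
        (mul_le_mul_of_nonneg_left (Real.exp_le_exp.2 ?_) (abs_nonneg _)))
      have : τ₂ * ‖z‖ ≤ |τ₂| * ‖z‖ := mul_le_mul_of_nonneg_right (le_abs_self _) (norm_nonneg _)
      linarith
    have g₃ : ‖E (2 * Real.pi * z)‖ ≤ |B₃| * Real.exp (T * ‖z‖) := by
      refine (hB₃ _).trans ((mul_le_mul_of_nonneg_right (le_abs_self _) (Real.exp_pos _).le).trans
        (mul_le_mul_of_nonneg_left (Real.exp_le_exp.2 ?_) (abs_nonneg _)))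
      rw [hz2]
      have : τ₃ * (2 * Real.pi * ‖z‖) ≤ |τ₃| * (2 * Real.pi * ‖z‖) :=
        mul_le_mul_of_nonneg_right (le_abs_self _) (by positivity)
      linarith
    have g₃' : ‖((2 * c₁ : ℝ) : ℂ) * E (2 * Real.pi * z)‖ ≤ 2 * |c₁| * |B₃| * Real.exp (T * ‖z‖) := by
      rw [norm_mul, Complex.norm_real, Real.norm_eq_abs, abs_mul, abs_two, mul_assoc (2 * |c₁|)]
      exact mul_le_mul_of_nonneg_left g₃ (by positivity)
    calc ‖Φ₁ z + Φ₂ z + ((2 * c₁ : ℝ) : ℂ) * E (2 * Real.pi * z)‖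
        ≤ ‖Φ₁ z‖ + ‖Φ₂ z‖ + ‖((2 * c₁ : ℝ) : ℂ) * E (2 * Real.pi * z)‖ := norm_add₃_le
      _ ≤ |B₁| * Real.exp (T * ‖z‖) + |B₂| * Real.exp (T * ‖z‖) + 2 * |c₁| * |B₃| * Real.exp (T * ‖z‖) := by
          gcongr
      _ = (|B₁| + |B₂| + 2 * |c₁| * |B₃|) * Real.exp (T * ‖z‖) := by ring
  · intro s hs
    have hlin : 𝓕 (fun x : ℝ => ∫ y : EuclideanSpace ℝ (Fin 2), G !₂[x, y 0, y 1]) s =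
        𝓕 Pbox s + 𝓕 Ptail s + 𝓕 PB s := by
      simp only [Real.fourier_real_eq_integral_exp_smul, smul_eq_mul]
      set e : ℝ → ℂ := fun x => Complex.exp (↑(-2 * Real.pi * x * s) * Complex.I) with he
      have he_c : Continuous e := by rw [he]; fun_prop
      have he_n : ∀ x, ‖e x‖ = 1 := fun x => Complex.norm_exp_ofReal_mul_I _
      have hint : ∀ {K : ℝ → ℂ}, Integrable K → Integrable fun x => e x * K x := fun hK =>
        hK.bdd_mul (c := 1) he_c.aestronglyMeasurable (ae_of_all _ fun x => (he_n x).le)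
      have : (fun x : ℝ => e x * ∫ y : EuclideanSpace ℝ (Fin 2), G !₂[x, y 0, y 1]) =
          fun x => e x * Pbox x + e x * Ptail x + e x * PB x := by
        funext x; rw [hsplit x]; ring
      have i12 : Integrable (fun x => e x * Pbox x + e x * Ptail x) := (hint hPbox_i).add (hint hPtail_i)
      rw [this, integral_add i12 (hint hPB_i), integral_add (hint hPbox_i) (hint hPtail_i)]
    show Φ₁ (s : ℂ) + Φ₂ (s : ℂ) + ((2 * c₁ : ℝ) : ℂ) * E (2 * Real.pi * (s : ℂ)) = _
    rw [hslice s, hlin, hΦ₁F s, hΦ₂F s, htail s hs]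
    push_cast
    ring


end Summit.AtomisticToContinuum.Crystallization.Theorems.ThreeConeCertificateExactCertificate.FarEqual

end
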